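import Literature.NumberTheory.Sieve.SmoothSaddleKernel
import Literature.NumberTheory.Sieve.SmoothSaddleWindowHT
import HarnessLib

/-!
# The saddle-point window on `Re s = α(x,y)` at SECOND order, symmetrised (abstract kernel)

Topic `Literature/NumberTheory/Sieve`; a PROVED tool file sharpening the window part of
`SmoothSaddleKernel` ([HildebrandTenenbaum1986, §4 (Lemma 11)]). With `α = α(x,y)`, `φ = φ₂(α,y)`,
`Φ₃ = −φ₃(α,y)`, `Φ₄ = φ₄(α,y)`, `e(t)` the saddle exponent and `f_A(t) = exp(e(t)) A(t)` for an
abstract kernel `A`, the window estimate `SaddleKernel.norm_windowIntegral_sub_le` expands `e(t)` to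
second order only and costs `(1475 B₀ log y + 4B₁)/φ`, i.e. a RELATIVE error `≍ log y/√φ ≍ √(log y/log x)`.
Here the window is treated at the next order, where the cubic term `iΦ₃t³/6` of `e(t)`
(`norm_saddleExponent_taylor_four`) and the linear term of `A` cancel by symmetry. To avoid derivatives
of `A` we SYMMETRISE: `∫_{[-τ,τ]} f_A = ∫_{[-τ,τ]} (f_A(t) + f_A(−t))/2`, and the kernel enters only
through `‖A(t) − A(0)‖ ≤ B₁|t|` and the second symmetric difference `‖A(t) + A(−t) − 2A(0)‖ ≤ B₂t²`:

* `norm_window_pointwise_symm` — the pointwise expansion of `e^{g(t)}A(t) + e^{g(−t)}A(−t) − 2e^{−φt²/2}A₀`;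
* `norm_windowIntegral_sub_le₂` — `‖∫_{[-τ,τ]} f_A − A(0)√(2π/φ)‖ ≤ ‖A 0‖e^{−φτ²/4}√(4π/φ)`
  `+ √(4π/φ)(c₂ (4/(eφ)) + c₄ (8/(eφ))² + c₆ (12/(eφ))³ + c₈ (16/(eφ))⁴)` with
  `c₂ = B₂/2`, `c₄ = 2B₁(Φ₃/6 + Φ₄τ) + ‖A 0‖Φ₄`, `c₆ = ‖A 0‖Φ₃²/18`, `c₈ = 2‖A 0‖Φ₄²`
  (`SaddleWindow.norm_setIntegral_window_sub_main_le` applied to the symmetrised integrand).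

The tails and the explicit constants are added in `SmoothSaddleKernelWindow2`.

## References

* A. Hildebrand, G. Tenenbaum, Trans. AMS 296 (1986), §4 (Lemma 11, (4.5)–(4.8)) [HildebrandTenenbaum1986].
* A. J. Harper, Compositio Math. 152 (2016), §5 [Harper2016].
-/

noncomputable section

open Real Complex MeasureTheory Set Filter
open scoped Topology

namespace Literature.NumberTheory.Sieve

namespace SaddleKernel

/-! ### The symmetrised pointwise expansion -/

/-- `‖e^w − 1‖ ≤ 2W` and `‖e^w − 1 − w‖ ≤ W²` when `‖w‖ ≤ W ≤ 1`. [folklore] -/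
theorem norm_exp_sub_one_le_of_le {w : ℂ} {W : ℝ} (hw : ‖w‖ ≤ W) (hW1 : W ≤ 1) :
    ‖Complex.exp w - 1‖ ≤ 2 * W ∧ ‖Complex.exp w - 1 - w‖ ≤ W ^ 2 := by
  have hw1 : ‖w‖ ≤ 1 := hw.trans hW1
  have h2 : ‖Complex.exp w - 1 - w‖ ≤ W ^ 2 :=
    (Complex.norm_exp_sub_one_sub_id_le hw1).trans (pow_le_pow_left₀ (norm_nonneg _) hw 2)
  refine ⟨?_, h2⟩
  have : Complex.exp w - 1 = (Complex.exp w - 1 - w) + w := by ring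
  rw [this]
  have hW0 : 0 ≤ W := le_trans (norm_nonneg _) hw
  calc ‖Complex.exp w - 1 - w + w‖ ≤ ‖Complex.exp w - 1 - w‖ + ‖w‖ := norm_add_le _ _
    _ ≤ W ^ 2 + W := add_le_add h2 hw
    _ ≤ 2 * W := by nlinarith

/-- **Pointwise symmetrised second-order expansion of the window integrand.** If
`‖g(u) + φu²/2 − iΦ₃u³/6‖ ≤ Φ₄u⁴` for all `u`, `Φ₃|t|³/6 + Φ₄t⁴ ≤ 1`, `|t| ≤ τ`,
`‖A(±t) − A₀‖ ≤ B₁|t|` and `‖A(t) + A(−t) − 2A₀‖ ≤ B₂t²`, then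
`‖e^{g(t)}A(t) + e^{g(−t)}A(−t) − 2e^{−φt²/2}A₀‖`
`≤ e^{−φt²/2}(B₂t² + (4B₁(Φ₃/6 + Φ₄τ) + 2‖A₀‖Φ₄)t⁴ + ‖A₀‖Φ₃²/9 · t⁶ + 4‖A₀‖Φ₄²t⁸)`:
the cubic terms `±iΦ₃t³/6` cancel in `w₊ + w₋` (`w_± = g(±t) + φt²/2`), and no linear term of `A` is
needed. [cite: HildebrandTenenbaum1986, §4 (4.5)–(4.7)] -/
theorem norm_window_pointwise_symm {g A : ℝ → ℂ} {φ Φ₃ Φ₄ B₁ B₂ τ t : ℝ} {A₀ : ℂ}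
    (hΦ₃ : 0 ≤ Φ₃) (hΦ₄ : 0 ≤ Φ₄) (hB₁ : 0 ≤ B₁)
    (hg : ∀ u : ℝ, ‖g u + ((φ / 2 * u ^ 2 : ℝ) : ℂ) - ((Φ₃ / 6 * u ^ 3 : ℝ) : ℂ) * I‖ ≤ Φ₄ * u ^ 4)
    (hsmall : Φ₃ / 6 * |t| ^ 3 + Φ₄ * t ^ 4 ≤ 1) (ht : |t| ≤ τ)
    (hA1 : ‖A t - A₀‖ ≤ B₁ * |t|) (hA1' : ‖A (-t) - A₀‖ ≤ B₁ * |t|)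
    (hA2 : ‖A t + A (-t) - 2 * A₀‖ ≤ B₂ * t ^ 2) :
    ‖Complex.exp (g t) * A t + Complex.exp (g (-t)) * A (-t) -
        2 * (((Real.exp (-(φ / 2) * t ^ 2) : ℝ) : ℂ) * A₀)‖ ≤
      Real.exp (-(φ / 2) * t ^ 2) *
        (B₂ * t ^ 2 + (4 * B₁ * (Φ₃ / 6 + Φ₄ * τ) + 2 * ‖A₀‖ * Φ₄) * t ^ 4 +
          ‖A₀‖ * Φ₃ ^ 2 / 9 * t ^ 6 + 4 * ‖A₀‖ * Φ₄ ^ 2 * t ^ 8) := by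
  -- notation
  set G : ℝ := Real.exp (-(φ / 2) * t ^ 2) with hG
  have hG0 : 0 < G := Real.exp_pos _
  set c : ℂ := ((Φ₃ / 6 * t ^ 3 : ℝ) : ℂ) * I with hc
  set wp : ℂ := g t + ((φ / 2 * t ^ 2 : ℝ) : ℂ) with hwp
  set wm : ℂ := g (-t) + ((φ / 2 * t ^ 2 : ℝ) : ℂ) with hwm
  set Rp : ℂ := wp - c with hRp
  set Rm : ℂ := wm + c with hRm
  set W : ℝ := Φ₃ / 6 * |t| ^ 3 + Φ₄ * t ^ 4 with hW
  have hW0 : 0 ≤ W := by positivity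
  have hW1 : W ≤ 1 := hsmall
  -- the two Taylor remainders
  have hRpn : ‖Rp‖ ≤ Φ₄ * t ^ 4 := by rw [hRp, hwp, hc]; exact hg t
  have hRmn : ‖Rm‖ ≤ Φ₄ * t ^ 4 := by
    have h := hg (-t)
    have e2 : (-t) ^ 2 = t ^ 2 := by ring
    have e3 : (-t) ^ 3 = -t ^ 3 := by ring
    have e4 : (-t) ^ 4 = t ^ 4 := by ring
    have e5 : ((Φ₃ / 6 * -t ^ 3 : ℝ) : ℂ) = -(((Φ₃ / 6 * t ^ 3 : ℝ)) : ℂ) := by push_cast; ring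
    rw [e2, e3, e4, e5, neg_mul, sub_neg_eq_add] at h
    rw [hRm, hwm, hc]; exact h
  have hcn : ‖c‖ = Φ₃ / 6 * |t| ^ 3 := by
    rw [hc, norm_mul, Complex.norm_I, mul_one, Complex.norm_real, Real.norm_eq_abs, abs_mul,
      abs_of_nonneg (by positivity : (0 : ℝ) ≤ Φ₃ / 6), abs_pow]
  have hwpn : ‖wp‖ ≤ W := by
    have : wp = c + Rp := by rw [hRp]; ring
    rw [this]
    calc ‖c + Rp‖ ≤ ‖c‖ + ‖Rp‖ := norm_add_le _ _
      _ ≤ Φ₃ / 6 * |t| ^ 3 + Φ₄ * t ^ 4 := by rw [hcn]; linarith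
  have hwmn : ‖wm‖ ≤ W := by
    have : wm = Rm - c := by rw [hRm]; ring
    rw [this]
    calc ‖Rm - c‖ ≤ ‖Rm‖ + ‖c‖ := norm_sub_le _ _
      _ ≤ Φ₄ * t ^ 4 + Φ₃ / 6 * |t| ^ 3 := by rw [hcn]; linarith
      _ = Φ₃ / 6 * |t| ^ 3 + Φ₄ * t ^ 4 := by ring
  -- `e^{g(±t)} = G e^{w±}`
  have hexpp : Complex.exp (g t) = (G : ℂ) * Complex.exp wp := by
    rw [hG, hwp, Complex.ofReal_exp, ← Complex.exp_add]
    congr 1; push_cast; ring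
  have hexpm : Complex.exp (g (-t)) = (G : ℂ) * Complex.exp wm := by
    rw [hG, hwm, Complex.ofReal_exp, ← Complex.exp_add]
    congr 1; push_cast; ring
  -- the algebraic decomposition (`wp + wm = Rp + Rm`)
  have hdecomp : Complex.exp (g t) * A t + Complex.exp (g (-t)) * A (-t) - 2 * ((G : ℂ) * A₀) =
      (G : ℂ) * ((A t + A (-t) - 2 * A₀) + (Complex.exp wp - 1) * (A t - A₀) +
        (Complex.exp wm - 1) * (A (-t) - A₀) +
        ((Complex.exp wp - 1 - wp) + (Complex.exp wm - 1 - wm) + (Rp + Rm)) * A₀) := by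
    rw [hexpp, hexpm, hRp, hRm]; ring
  rw [hdecomp, norm_mul, Complex.norm_real, Real.norm_eq_abs, abs_of_pos hG0]
  refine mul_le_mul_of_nonneg_left ?_ hG0.le
  -- the pieces
  obtain ⟨hp1, hp2⟩ := norm_exp_sub_one_le_of_le hwpn hW1
  obtain ⟨hm1, hm2⟩ := norm_exp_sub_one_le_of_le hwmn hW1
  have ht0 : 0 ≤ |t| := abs_nonneg t
  have k1 : ‖(Complex.exp wp - 1) * (A t - A₀)‖ ≤ 2 * W * (B₁ * |t|) := by
    rw [norm_mul]; exact mul_le_mul hp1 hA1 (norm_nonneg _) (by positivity)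
  have k2 : ‖(Complex.exp wm - 1) * (A (-t) - A₀)‖ ≤ 2 * W * (B₁ * |t|) := by
    rw [norm_mul]; exact mul_le_mul hm1 hA1' (norm_nonneg _) (by positivity)
  have k3 : ‖((Complex.exp wp - 1 - wp) + (Complex.exp wm - 1 - wm) + (Rp + Rm)) * A₀‖ ≤
      (W ^ 2 + W ^ 2 + (Φ₄ * t ^ 4 + Φ₄ * t ^ 4)) * ‖A₀‖ := by
    rw [norm_mul]
    refine mul_le_mul_of_nonneg_right ?_ (norm_nonneg _)
    calc ‖(Complex.exp wp - 1 - wp) + (Complex.exp wm - 1 - wm) + (Rp + Rm)‖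
        ≤ ‖(Complex.exp wp - 1 - wp) + (Complex.exp wm - 1 - wm)‖ + ‖Rp + Rm‖ := norm_add_le _ _
      _ ≤ (‖Complex.exp wp - 1 - wp‖ + ‖Complex.exp wm - 1 - wm‖) + (‖Rp‖ + ‖Rm‖) :=
          add_le_add (norm_add_le _ _) (norm_add_le _ _)
      _ ≤ _ := add_le_add (add_le_add hp2 hm2) (add_le_add hRpn hRmn)
  -- elementary inequalities in `t`
  have habs2 : |t| ^ 2 = t ^ 2 := sq_abs t
  have habs3t : |t| ^ 3 * |t| = t ^ 4 := by
    have : |t| ^ 3 * |t| = (|t| ^ 2) ^ 2 := by ring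
    rw [this, habs2]; ring
  have habs6 : (|t| ^ 3) ^ 2 = t ^ 6 := by
    have : (|t| ^ 3) ^ 2 = (|t| ^ 2) ^ 3 := by ring
    rw [this, habs2]; ring
  have hWt : W * |t| ≤ Φ₃ / 6 * t ^ 4 + Φ₄ * τ * t ^ 4 := by
    rw [hW, add_mul, mul_assoc, habs3t]
    have h5 : Φ₄ * t ^ 4 * |t| ≤ Φ₄ * τ * t ^ 4 := by
      calc Φ₄ * t ^ 4 * |t| = Φ₄ * t ^ 4 * |t| := rfl
        _ ≤ Φ₄ * t ^ 4 * τ := mul_le_mul_of_nonneg_left ht (by positivity)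
        _ = Φ₄ * τ * t ^ 4 := by ring
    linarith
  have hW2 : W ^ 2 ≤ 2 * ((Φ₃ / 6) ^ 2 * t ^ 6 + Φ₄ ^ 2 * t ^ 8) := by
    rw [hW]
    have hab : ∀ a b : ℝ, (a + b) ^ 2 ≤ 2 * (a ^ 2 + b ^ 2) := fun a b => by nlinarith [sq_nonneg (a - b)]
    calc (Φ₃ / 6 * |t| ^ 3 + Φ₄ * t ^ 4) ^ 2 ≤ 2 * ((Φ₃ / 6 * |t| ^ 3) ^ 2 + (Φ₄ * t ^ 4) ^ 2) := hab _ _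
      _ = 2 * ((Φ₃ / 6) ^ 2 * t ^ 6 + Φ₄ ^ 2 * t ^ 8) := by rw [mul_pow, habs6]; ring
  have hA₀ := norm_nonneg A₀
  calc ‖(A t + A (-t) - 2 * A₀) + (Complex.exp wp - 1) * (A t - A₀) + (Complex.exp wm - 1) * (A (-t) - A₀) +
        ((Complex.exp wp - 1 - wp) + (Complex.exp wm - 1 - wm) + (Rp + Rm)) * A₀‖
      ≤ ‖(A t + A (-t) - 2 * A₀) + (Complex.exp wp - 1) * (A t - A₀) + (Complex.exp wm - 1) * (A (-t) - A₀)‖ +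
          ‖((Complex.exp wp - 1 - wp) + (Complex.exp wm - 1 - wm) + (Rp + Rm)) * A₀‖ := norm_add_le _ _
    _ ≤ ‖(A t + A (-t) - 2 * A₀) + (Complex.exp wp - 1) * (A t - A₀)‖ + ‖(Complex.exp wm - 1) * (A (-t) - A₀)‖ +
          ‖((Complex.exp wp - 1 - wp) + (Complex.exp wm - 1 - wm) + (Rp + Rm)) * A₀‖ := by
        gcongr; exact norm_add_le _ _
    _ ≤ ‖A t + A (-t) - 2 * A₀‖ + ‖(Complex.exp wp - 1) * (A t - A₀)‖ + ‖(Complex.exp wm - 1) * (A (-t) - A₀)‖ +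
          ‖((Complex.exp wp - 1 - wp) + (Complex.exp wm - 1 - wm) + (Rp + Rm)) * A₀‖ := by
        gcongr; exact norm_add_le _ _
    _ ≤ B₂ * t ^ 2 + 2 * W * (B₁ * |t|) + 2 * W * (B₁ * |t|) +
          (W ^ 2 + W ^ 2 + (Φ₄ * t ^ 4 + Φ₄ * t ^ 4)) * ‖A₀‖ := by
        linarith [hA2, k1, k2, k3]
    _ = B₂ * t ^ 2 + 4 * B₁ * (W * |t|) + ‖A₀‖ * (2 * W ^ 2) + 2 * ‖A₀‖ * Φ₄ * t ^ 4 := by ring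
    _ ≤ B₂ * t ^ 2 + 4 * B₁ * (Φ₃ / 6 * t ^ 4 + Φ₄ * τ * t ^ 4) +
          ‖A₀‖ * (2 * (2 * ((Φ₃ / 6) ^ 2 * t ^ 6 + Φ₄ ^ 2 * t ^ 8))) + 2 * ‖A₀‖ * Φ₄ * t ^ 4 := by
        gcongr
    _ = B₂ * t ^ 2 + (4 * B₁ * (Φ₃ / 6 + Φ₄ * τ) + 2 * ‖A₀‖ * Φ₄) * t ^ 4 +
          ‖A₀‖ * Φ₃ ^ 2 / 9 * t ^ 6 + 4 * ‖A₀‖ * Φ₄ ^ 2 * t ^ 8 := by ring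

/-! ### The window integral at second order -/

set_option maxHeartbeats 800000 in
/-- **The window integral with an abstract kernel, at second order.** For `x > 1`, `y ≥ 2`,
`α = α(x,y)`, `φ = φ₂(α,y)`, a window `0 ≤ τ ≤ 1` with `Φ₃τ³/6 + Φ₄τ⁴ ≤ 1`, and a continuous kernel with
`‖A t − A 0‖ ≤ B₁|t|`, `‖A t + A(−t) − 2A 0‖ ≤ B₂t²` (`|t| ≤ 1`):
`‖∫_{[-τ,τ]} f_A − A(0)√(2π/φ)‖ ≤ ‖A 0‖e^{−φτ²/4}√(4π/φ)`
`+ √(4π/φ)((B₂/2)(4/(eφ)) + (2B₁(Φ₃/6 + Φ₄τ) + ‖A 0‖Φ₄)(8/(eφ))² + (‖A 0‖Φ₃²/18)(12/(eφ))³ + 2‖A 0‖Φ₄²(16/(eφ))⁴)`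
(symmetrise, `norm_window_pointwise_symm`, `SaddleWindow.norm_setIntegral_window_sub_main_le`).
[cite: HildebrandTenenbaum1986, §4 (Lemma 11)] -/
theorem norm_windowIntegral_sub_le₂ {x τ B₁ B₂ : ℝ} {y : ℕ} {A : ℝ → ℂ} (hx : 1 < x) (hy : 2 ≤ y)
    (hτ0 : 0 ≤ τ) (hτ1 : τ ≤ 1)
    (hη₂ : saddlePhi₃ (saddlePoint x y) y / 6 * τ ^ 3 + saddlePhi₄ (saddlePoint x y) y * τ ^ 4 ≤ 1)
    (hA : Continuous A) (hB₁ : 0 ≤ B₁) (hB₂ : 0 ≤ B₂)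
    (hB1 : ∀ t : ℝ, |t| ≤ 1 → ‖A t - A 0‖ ≤ B₁ * |t|)
    (hB2 : ∀ t : ℝ, |t| ≤ 1 → ‖A t + A (-t) - 2 * A 0‖ ≤ B₂ * t ^ 2) :
    ‖(∫ t in Icc (-τ) τ, kernelIntegrand x (saddlePoint x y) y A t) -
        A 0 * (Real.sqrt (2 * Real.pi / saddlePhi₂ (saddlePoint x y) y) : ℂ)‖ ≤
      ‖A 0‖ * (Real.exp (-(saddlePhi₂ (saddlePoint x y) y / 4) * τ ^ 2) *
          Real.sqrt (4 * Real.pi / saddlePhi₂ (saddlePoint x y) y)) +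
        Real.sqrt (4 * Real.pi / saddlePhi₂ (saddlePoint x y) y) *
          (B₂ / 2 * (4 * 1 / (Real.exp 1 * saddlePhi₂ (saddlePoint x y) y)) ^ 1 +
            (2 * B₁ * (saddlePhi₃ (saddlePoint x y) y / 6 + saddlePhi₄ (saddlePoint x y) y * τ) +
                ‖A 0‖ * saddlePhi₄ (saddlePoint x y) y) *
              (4 * 2 / (Real.exp 1 * saddlePhi₂ (saddlePoint x y) y)) ^ 2 +
            ‖A 0‖ * saddlePhi₃ (saddlePoint x y) y ^ 2 / 18 *
              (4 * 3 / (Real.exp 1 * saddlePhi₂ (saddlePoint x y) y)) ^ 3 +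
            2 * ‖A 0‖ * saddlePhi₄ (saddlePoint x y) y ^ 2 *
              (4 * 4 / (Real.exp 1 * saddlePhi₂ (saddlePoint x y) y)) ^ 4) := by
  set α : ℝ := saddlePoint x y with hαdef
  have hα0 : 0 < α := saddlePoint_pos hx hy
  set φ : ℝ := saddlePhi₂ α y with hφ
  set Φ₃ : ℝ := saddlePhi₃ α y with hΦ₃
  set Φ₄ : ℝ := saddlePhi₄ α y with hΦ₄
  have hφ0 : 0 < φ := saddlePhi₂_pos hy hα0
  have hΦ₃0 : 0 ≤ Φ₃ := saddlePhi₃_nonneg hα0 y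
  have hΦ₄0 : 0 ≤ Φ₄ := saddlePhi₄_nonneg hα0 y
  set S := Icc (-τ) τ with hS
  -- the integrand, its reflection, and the symmetrisation
  have hFc : Continuous (kernelIntegrand x α y A) := continuous_kernelIntegrand hα0 x y hA
  set Fs : ℝ → ℂ := fun t => (kernelIntegrand x α y A t + kernelIntegrand x α y A (-t)) / 2 with hFs
  set Od : ℝ → ℂ := fun t => (kernelIntegrand x α y A t - kernelIntegrand x α y A (-t)) / 2 with hOd
  have hFm : Continuous fun t : ℝ => kernelIntegrand x α y A (-t) := hFc.comp continuous_neg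
  have hFs_c : Continuous Fs := by simp only [hFs]; exact (hFc.add hFm).div_const _
  have hOd_c : Continuous Od := by simp only [hOd]; exact (hFc.sub hFm).div_const _
  have hFs_i : IntegrableOn Fs S := hFs_c.continuousOn.integrableOn_compact isCompact_Icc
  have hOd_i : IntegrableOn Od S := hOd_c.continuousOn.integrableOn_compact isCompact_Icc
  have hOd0 : ∫ t in S, Od t = 0 :=
    SaddleWindow.integral_Icc_eq_zero_of_odd τ fun t => by simp only [hOd, neg_neg]; ring
  have hsym : (∫ t in S, kernelIntegrand x α y A t) = ∫ t in S, Fs t := by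
    calc (∫ t in S, kernelIntegrand x α y A t) = ∫ t in S, (Fs t + Od t) := by
          refine integral_congr_ae (Eventually.of_forall fun t => ?_)
          simp only [hFs, hOd]; ring
      _ = (∫ t in S, Fs t) + ∫ t in S, Od t := integral_add hFs_i hOd_i
      _ = ∫ t in S, Fs t := by rw [hOd0, add_zero]
  rw [hsym]
  -- apply the abstract window lemma to `Fs` with `A₁ = 0`, cubic coefficient `0`
  have hmain := SaddleWindow.norm_setIntegral_window_sub_main_le (F := Fs) (φ := φ) (Φ₃ := 0) (τ := τ)
    (c₂ := B₂ / 2) (c₄ := 2 * B₁ * (Φ₃ / 6 + Φ₄ * τ) + ‖A 0‖ * Φ₄) (c₆ := ‖A 0‖ * Φ₃ ^ 2 / 18)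
    (c₈ := 2 * ‖A 0‖ * Φ₄ ^ 2) (A₀ := A 0) (A₁ := 0) hφ0 hτ0 (by positivity) (by positivity)
    (by positivity) (by positivity) hFs_i
  refine hmain fun t ht => ?_
  have htabs : |t| ≤ τ := abs_le.2 ⟨ht.1, ht.2⟩
  have ht1 : |t| ≤ 1 := htabs.trans hτ1
  have hsmall_t : Φ₃ / 6 * |t| ^ 3 + Φ₄ * t ^ 4 ≤ 1 := by
    have h3 : |t| ^ 3 ≤ τ ^ 3 := pow_le_pow_left₀ (abs_nonneg t) htabs 3
    have h4 : t ^ 4 ≤ τ ^ 4 := by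
      have := pow_le_pow_left₀ (abs_nonneg t) htabs 4
      rwa [(show Even 4 from ⟨2, rfl⟩).pow_abs] at this
    calc Φ₃ / 6 * |t| ^ 3 + Φ₄ * t ^ 4 ≤ Φ₃ / 6 * τ ^ 3 + Φ₄ * τ ^ 4 := by gcongr
      _ ≤ 1 := hη₂
  have hmodel : A 0 + A 0 * ((((0 : ℝ) / 6 * t ^ 3 : ℝ) : ℂ) * I) + 0 * (t : ℂ) = A 0 := by simp
  rw [hmodel]
  have hB1m : ‖A (-t) - A 0‖ ≤ B₁ * |t| := by
    have := hB1 (-t) (by rwa [abs_neg]); rwa [abs_neg] at this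
  have key := norm_window_pointwise_symm (g := fun u : ℝ => saddleExponent x α y u) (A := A) (A₀ := A 0)
    (φ := φ) hΦ₃0 hΦ₄0 hB₁ (fun u => norm_saddleExponent_taylor_four hx hy u) hsmall_t htabs (hB1 t ht1)
    hB1m (hB2 t ht1)
  have hhalf : Fs t - ((Real.exp (-(φ / 2) * t ^ 2) : ℝ) : ℂ) * A 0 =
      (1 / 2 : ℂ) * (Complex.exp (saddleExponent x α y t) * A t +
        Complex.exp (saddleExponent x α y ((-t : ℝ) : ℂ)) * A (-t) -
        2 * (((Real.exp (-(φ / 2) * t ^ 2) : ℝ) : ℂ) * A 0)) := by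
    simp only [hFs, kernelIntegrand]; ring
  rw [hhalf, norm_mul]
  have hn2 : ‖(1 / 2 : ℂ)‖ = 1 / 2 := by
    rw [norm_div, norm_one, Complex.norm_ofNat]
  rw [hn2]
  have hG0 : 0 < Real.exp (-(φ / 2) * t ^ 2) := Real.exp_pos _
  calc 1 / 2 * ‖Complex.exp (saddleExponent x α y t) * A t + Complex.exp (saddleExponent x α y ((-t : ℝ) : ℂ)) * A (-t) -
        2 * (((Real.exp (-(φ / 2) * t ^ 2) : ℝ) : ℂ) * A 0)‖
      ≤ 1 / 2 * (Real.exp (-(φ / 2) * t ^ 2) *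
          (B₂ * t ^ 2 + (4 * B₁ * (Φ₃ / 6 + Φ₄ * τ) + 2 * ‖A 0‖ * Φ₄) * t ^ 4 +
            ‖A 0‖ * Φ₃ ^ 2 / 9 * t ^ 6 + 4 * ‖A 0‖ * Φ₄ ^ 2 * t ^ 8)) :=
        mul_le_mul_of_nonneg_left key (by norm_num)
    _ = Real.exp (-(φ / 2) * t ^ 2) * (B₂ / 2 * t ^ 2 + (2 * B₁ * (Φ₃ / 6 + Φ₄ * τ) + ‖A 0‖ * Φ₄) * t ^ 4 +
          ‖A 0‖ * Φ₃ ^ 2 / 18 * t ^ 6 + 2 * ‖A 0‖ * Φ₄ ^ 2 * t ^ 8) := by ring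

end SaddleKernel

end Literature.NumberTheory.Sieve

end
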